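import Mathlib
import Summits.NavierStokesRegularity.NavierStokesRegularity.Theorems.DssFarFieldSlavingBlowupTypeIDssProfileGaussianGapTypeI
import Literature.Analysis.FluidPDE.EnergyUniqueness
import Summits.NavierStokesRegularity.NavierStokesRegularity.Theorems.PlaneEnergyCeilingPlanarEnergyAPrioriSlabLawDecay
import HarnessLib

/-!
# Similarity enstrophy, file 2/4: the decay hypothesis (D) in similarity variables — pointwise bounds
  and the similarity vorticity equation as an `s`-derivative (pub-ns-dss theory T38-SCOPE (S1);
  route `DssFarFieldSlaving`, crux `BlowupTypeIDssProfile`, stmt-NavierStokesRegularity-0155 —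
  SUPPORT, label-free helper; typer seat g6, 2026-08-23)

HONEST FRAMING. Label-free analysis helper for the T38-SCOPE plan of the cell's theory seat (S3 → S2 → S1 → S4;
LIOUVILLE-SIDE l.177): an IDENTITY / estimates for a HYPOTHETICAL object (the similarity vorticity of a Type-I ancient mild
field) under the NAMED space–time decay hypothesis (D), which is NOT derived from Type-I membership here. No census words
change (the explicit rows T31″ / T34 / T38 stay DERIVED until S4 lands); nothing numeric; nothing here bears on Navier–Stokes
regularity or blow-up. Idea credit for the Hardy-weighted stretching threshold: the OPEN item
`StretchingWellBinding.DssProfileBinding` (stmt-1578), not addressed here.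

CONTENTS. For a KNSS-gauge Type-I field `V` (`IsTypeIAncientMild M V`) and the decay hypothesis (D) at
order `k` — `(‖x‖ + √(−t))^{k+1} ‖DᵏV(t)(x)‖ ≤ C_k` for all `t < 0`, `x` (the token shape of
`StretchingWellBinding.DssProfileBinding`) — the similarity slices `U = lerayOrbit V` obey
`(1 + ‖y‖)^{k+1} ‖DᵏU(s)(y)‖ ≤ C_k` (`pow_mul_norm_iteratedFDeriv_lerayOrbit_le`, via the tree's
`GaussianGap.iteratedFDeriv_lerayOrbit_slice`); hence for the similarity vorticity
`Ω = lerayVorticity V = curl U`: `‖Ω‖ ≲ (1+|y|)^{−2}` (k = 1), `‖DΩ‖ ≲ (1+|y|)^{−3}` (k = 2),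
`‖D²Ω‖, ‖ΔΩ‖ ≲ (1+|y|)^{−4}` (k = 3), `‖DU‖ ≲ (1+|y|)^{−2}`, uniformly in `s`; and
`lerayVorticity_hasDerivAt`: `∂ₛΩ = ΔΩ − Ω − ½DΩ(y) − DΩ(U) + DU(Ω)` pointwise as a `HasDerivAt`
(the tree's `IsTypeIAncientMild.lerayVorticity_eq`; adapted from `GaussianGapTypeI`).
[this file; folklore; theory T38-SCOPE (S1) binders (α) 2026-08-23]
-/

noncomputable section

set_option linter.dupNamespace false

namespace Summit.NavierStokesRegularity.NavierStokesRegularity.Theorems.SimilarityEnstrophy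

open MeasureTheory Set Filter Topology Module Metric InnerProductSpace Function
open scoped RealInnerProductSpace Laplacian ContDiff
open Literature.Analysis Literature.Analysis.FluidPDE
open Summit.NavierStokesRegularity.NavierStokesRegularity.Theorems.GaussianGap
open Summit.NavierStokesRegularity.NavierStokesRegularity.Theorems.PlanarEnergyAPriori

variable {M : ℝ} {V : ℝ → EuclideanSpace ℝ (Fin 3) → EuclideanSpace ℝ (Fin 3)}

/-! ### Elementary decay-weight algebra -/

/-- `‖y‖ (1 + ‖y‖)^{−a} ≤ (1 + ‖y‖)^{−(a−1)}`. [folklore] -/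
theorem norm_mul_decay_le (y : EuclideanSpace ℝ (Fin 3)) (a : ℝ) :
    ‖y‖ * (1 + ‖y‖) ^ (-a) ≤ (1 + ‖y‖) ^ (-(a - 1)) := by
  have h1 : ‖y‖ ≤ (1 + ‖y‖) ^ (1 : ℝ) := by rw [Real.rpow_one]; linarith [norm_nonneg y]
  calc ‖y‖ * (1 + ‖y‖) ^ (-a) ≤ (1 + ‖y‖) ^ (1 : ℝ) * (1 + ‖y‖) ^ (-a) :=
        mul_le_mul_of_nonneg_right h1 (Real.rpow_nonneg (by positivity) _)
    _ = (1 + ‖y‖) ^ (-(a - 1)) := by rw [← Real.rpow_add (by positivity)]; ring_nf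

/-! ### (D) transported to similarity variables -/

/-- **The space–time decay hypothesis (D) in similarity variables.** If
`(‖x‖ + √(−t))^{k+1} ‖DᵏV(t)(x)‖ ≤ C` for all `t < 0`, `x`, then the similarity slices obey
`(1 + ‖y‖)^{k+1} ‖DᵏU(s)(y)‖ ≤ C` for all `s`, `y` (`DᵏU(s)(y) = c^{k+1} DᵏV(t)(cy)`, `c = e^{−s/2} = √(−t)`,
`‖cy‖ + c = c(1 + ‖y‖)`). [folklore] -/
theorem pow_mul_norm_iteratedFDeriv_lerayOrbit_le (hV : IsTypeIAncientMild M V) {k : ℕ} {C : ℝ}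
    (hD : ∀ t < 0, ∀ x, (‖x‖ + Real.sqrt (-t)) ^ (k + 1) * ‖iteratedFDeriv ℝ k (V t) x‖ ≤ C)
    (s : ℝ) (y : EuclideanSpace ℝ (Fin 3)) :
    (1 + ‖y‖) ^ (k + 1) * ‖iteratedFDeriv ℝ k (lerayOrbit V s) y‖ ≤ C := by
  set c : ℝ := Real.exp (-s / 2) with hc
  have hcpos : 0 < c := Real.exp_pos _
  have ht : -Real.exp (-s) < 0 := neg_neg_of_pos (Real.exp_pos _)
  have hsq : Real.sqrt (-(-Real.exp (-s))) = c := by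
    rw [neg_neg, ← exp_neg_half_sq, Real.sqrt_sq hcpos.le]
  have h := hD _ ht (c • y)
  rw [hsq, norm_smul, Real.norm_of_nonneg hcpos.le, show c * ‖y‖ + c = c * (1 + ‖y‖) by ring,
    mul_pow] at h
  rw [iteratedFDeriv_lerayOrbit_slice hV s k y, norm_smul, norm_pow, Real.norm_of_nonneg hcpos.le]
  calc (1 + ‖y‖) ^ (k + 1) * (c ^ (k + 1) * ‖iteratedFDeriv ℝ k (V (-Real.exp (-s))) (c • y)‖)
      = c ^ (k + 1) * (1 + ‖y‖) ^ (k + 1) * ‖iteratedFDeriv ℝ k (V (-Real.exp (-s))) (c • y)‖ := by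
        ring
    _ ≤ C := h

/-- The same bound in decay form: `‖DᵏU(s)(y)‖ ≤ C (1 + ‖y‖)^{−(k+1)}`. [folklore] -/
theorem norm_iteratedFDeriv_lerayOrbit_le_decay (hV : IsTypeIAncientMild M V) {k : ℕ} {C : ℝ}
    (hD : ∀ t < 0, ∀ x, (‖x‖ + Real.sqrt (-t)) ^ (k + 1) * ‖iteratedFDeriv ℝ k (V t) x‖ ≤ C)
    (s : ℝ) (y : EuclideanSpace ℝ (Fin 3)) :
    ‖iteratedFDeriv ℝ k (lerayOrbit V s) y‖ ≤ C * (1 + ‖y‖) ^ (-((k : ℝ) + 1)) := by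
  have h := pow_mul_norm_iteratedFDeriv_lerayOrbit_le hV hD s y
  have hpos : 0 < (1 + ‖y‖) ^ (k + 1) := by positivity
  rw [Real.rpow_neg (by positivity), show ((k : ℝ) + 1) = ((k + 1 : ℕ) : ℝ) by push_cast; ring,
    Real.rpow_natCast, ← div_eq_mul_inv, le_div_iff₀ hpos, mul_comm]
  exact h

/-- A decay constant of (D) is non-negative (it bounds a norm at `t = −1`, `x = 0`). [folklore] -/
theorem decayConst_nonneg {k : ℕ} {C : ℝ}
    (hD : ∀ t < 0, ∀ x, (‖x‖ + Real.sqrt (-t)) ^ (k + 1) * ‖iteratedFDeriv ℝ k (V t) x‖ ≤ C) :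
    0 ≤ C :=
  le_trans (by positivity) (hD (-1) (by norm_num) 0)

/-! ### Pointwise bounds on the similarity vorticity `Ω = lerayVorticity V = curl U` -/

section Bounds

variable (hV : IsTypeIAncientMild M V)
include hV

/-- `‖DU(s)(y)‖ ≤ C₁ (1 + ‖y‖)^{−2}` from (D) at `k = 1`. [folklore] -/
theorem norm_fderiv_lerayOrbit_le_decay {C₁ : ℝ}
    (hD1 : ∀ t < 0, ∀ x, (‖x‖ + Real.sqrt (-t)) ^ (1 + 1) * ‖iteratedFDeriv ℝ 1 (V t) x‖ ≤ C₁)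
    (s : ℝ) (y : EuclideanSpace ℝ (Fin 3)) :
    ‖fderiv ℝ (lerayOrbit V s) y‖ ≤ C₁ * (1 + ‖y‖) ^ (-(2 : ℝ)) := by
  have h := norm_iteratedFDeriv_lerayOrbit_le_decay hV hD1 s y
  rw [norm_iteratedFDeriv_one, show (-(((1 : ℕ) : ℝ) + 1)) = (-(2 : ℝ)) by norm_num] at h
  exact h

/-- `‖Ω(s)(y)‖ ≤ ‖curl‖ C₁ (1 + ‖y‖)^{−2}` from (D) at `k = 1`. [folklore] -/
theorem norm_lerayVorticity_le_decay {C₁ : ℝ}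
    (hD1 : ∀ t < 0, ∀ x, (‖x‖ + Real.sqrt (-t)) ^ (1 + 1) * ‖iteratedFDeriv ℝ 1 (V t) x‖ ≤ C₁)
    (s : ℝ) (y : EuclideanSpace ℝ (Fin 3)) :
    ‖lerayVorticity V s y‖ ≤ ‖curlCLM‖ * C₁ * (1 + ‖y‖) ^ (-(2 : ℝ)) := by
  rw [mul_assoc]
  exact (norm_curl_le (lerayOrbit V s) y).trans
    (mul_le_mul_of_nonneg_left (norm_fderiv_lerayOrbit_le_decay hV hD1 s y) (norm_nonneg curlCLM))

/-- `‖DΩ(s)(y)‖ ≤ ‖curl‖ C₂ (1 + ‖y‖)^{−3}` from (D) at `k = 2`. [folklore] -/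
theorem norm_fderiv_lerayVorticity_le_decay {C₂ : ℝ}
    (hD2 : ∀ t < 0, ∀ x, (‖x‖ + Real.sqrt (-t)) ^ (2 + 1) * ‖iteratedFDeriv ℝ 2 (V t) x‖ ≤ C₂)
    (s : ℝ) (y : EuclideanSpace ℝ (Fin 3)) :
    ‖fderiv ℝ (lerayVorticity V s) y‖ ≤ ‖curlCLM‖ * C₂ * (1 + ‖y‖) ^ (-(3 : ℝ)) := by
  have hU3 : ContDiff ℝ 3 (lerayOrbit V s) := contDiff_lerayOrbit_slice_of_typeI hV s (by norm_cast)
  have hd : DifferentiableAt ℝ (fderiv ℝ (lerayOrbit V s)) y :=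
    ((hU3.fderiv_right (m := 2) (by norm_cast)).differentiable (by norm_num)) y
  have hDΩ : fderiv ℝ (lerayVorticity V s) y =
      curlCLM.comp (fderiv ℝ (fderiv ℝ (lerayOrbit V s)) y) := by
    rw [show lerayVorticity V s = curl (lerayOrbit V s) from rfl, curl_eq_curlCLM_comp]
    exact (curlCLM.hasFDerivAt.comp y hd.hasFDerivAt).fderiv
  rw [hDΩ, mul_assoc]
  refine (ContinuousLinearMap.opNorm_comp_le _ _).trans (mul_le_mul_of_nonneg_left ?_ (norm_nonneg _))
  rw [← norm_iteratedFDeriv_one, norm_iteratedFDeriv_fderiv]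
  have h := norm_iteratedFDeriv_lerayOrbit_le_decay hV hD2 s y
  rw [show (-(((2 : ℕ) : ℝ) + 1)) = (-(3 : ℝ)) by norm_num] at h
  exact h

/-- `‖D²Ω(s)(y)‖ ≤ ‖curl‖ C₃ (1 + ‖y‖)^{−4}` (as `‖D(DΩ)‖`) from (D) at `k = 3`. [folklore] -/
theorem norm_fderiv_fderiv_lerayVorticity_le_decay {C₃ : ℝ}
    (hD3 : ∀ t < 0, ∀ x, (‖x‖ + Real.sqrt (-t)) ^ (3 + 1) * ‖iteratedFDeriv ℝ 3 (V t) x‖ ≤ C₃)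
    (s : ℝ) (y : EuclideanSpace ℝ (Fin 3)) :
    ‖fderiv ℝ (fderiv ℝ (lerayVorticity V s)) y‖ ≤ ‖curlCLM‖ * C₃ * (1 + ‖y‖) ^ (-(4 : ℝ)) := by
  have hU4 : ContDiff ℝ 4 (lerayOrbit V s) := contDiff_lerayOrbit_slice_of_typeI hV s (by norm_cast)
  have hf3 : ContDiff ℝ 3 (fderiv ℝ (lerayOrbit V s)) := hU4.fderiv_right (m := 3) (by norm_cast)
  rw [← norm_iteratedFDeriv_one, norm_iteratedFDeriv_fderiv,
    show lerayVorticity V s = curl (lerayOrbit V s) from rfl, curl_eq_curlCLM_comp,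
    curlCLM.iteratedFDeriv_comp_left (hf3.contDiffAt) (by norm_cast), mul_assoc]
  refine (ContinuousLinearMap.norm_compContinuousMultilinearMap_le _ _).trans
    (mul_le_mul_of_nonneg_left ?_ (norm_nonneg _))
  rw [norm_iteratedFDeriv_fderiv]
  have h := norm_iteratedFDeriv_lerayOrbit_le_decay hV hD3 s y
  rw [show (-(((3 : ℕ) : ℝ) + 1)) = (-(4 : ℝ)) by norm_num] at h
  exact h

/-- `‖ΔΩ(s)(y)‖ ≤ 3 ‖curl‖ C₃ (1 + ‖y‖)^{−4}`. [folklore] -/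
theorem norm_laplacian_lerayVorticity_le_decay {C₃ : ℝ}
    (hD3 : ∀ t < 0, ∀ x, (‖x‖ + Real.sqrt (-t)) ^ (3 + 1) * ‖iteratedFDeriv ℝ 3 (V t) x‖ ≤ C₃)
    (s : ℝ) (y : EuclideanSpace ℝ (Fin 3)) :
    ‖(Δ (lerayVorticity V s)) y‖ ≤ 3 * (‖curlCLM‖ * C₃) * (1 + ‖y‖) ^ (-(4 : ℝ)) := by
  have h := norm_laplacian_le (lerayVorticity V s) y
  rw [finrank_euclideanSpace_fin] at h
  calc ‖(Δ (lerayVorticity V s)) y‖ ≤ 3 * ‖fderiv ℝ (fderiv ℝ (lerayVorticity V s)) y‖ := by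
        exact_mod_cast h
    _ ≤ 3 * (‖curlCLM‖ * C₃ * (1 + ‖y‖) ^ (-(4 : ℝ))) := by
        gcongr; exact norm_fderiv_fderiv_lerayVorticity_le_decay hV hD3 s y
    _ = 3 * (‖curlCLM‖ * C₃) * (1 + ‖y‖) ^ (-(4 : ℝ)) := by ring

end Bounds

/-! ### The similarity vorticity equation as a pointwise `s`-derivative -/

/-- **`∂ₛΩ = ΔΩ − Ω − ½ DΩ(y) − DΩ(U) + DU(Ω)` pointwise, as a `HasDerivAt` in `s`** for the
similarity vorticity `Ω = lerayVorticity V` of a KNSS-gauge Type-I field (the tree's all-`s` equation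
`IsTypeIAncientMild.lerayVorticity_eq`, and differentiability in `s` from the joint smoothness of the
similarity orbit). [cite: MajdaBertozziCUP2002, §2.4 Prop. 2.4 eq. (2.110)] -/
theorem lerayVorticity_hasDerivAt (hV : IsTypeIAncientMild M V) (s : ℝ) (y : EuclideanSpace ℝ (Fin 3)) :
    HasDerivAt (fun σ => lerayVorticity V σ y)
      ((Δ (lerayVorticity V s)) y - lerayVorticity V s y
        - (1 / 2 : ℝ) • fderiv ℝ (lerayVorticity V s) y y
        - fderiv ℝ (lerayVorticity V s) y (lerayOrbit V s y)
        + fderiv ℝ (lerayOrbit V s) y (lerayVorticity V s y)) s := by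
  -- adapted from `GaussianGap.typeI_ancient_gaussianGap_eq_zero` (tree)
  have hLO := contDiff_uncurry_lerayOrbit_of_typeI hV
  have hG : ContDiff ℝ 1 fun p : ℝ × EuclideanSpace ℝ (Fin 3) => fderiv ℝ (lerayOrbit V p.1) p.2 := by
    have hf : ContDiff ℝ (⊤ : ℕ∞) (uncurry fun p : ℝ × EuclideanSpace ℝ (Fin 3) => lerayOrbit V p.1) := by
      have e : (uncurry fun p : ℝ × EuclideanSpace ℝ (Fin 3) => lerayOrbit V p.1) =
          uncurry (lerayOrbit V) ∘ fun q : (ℝ × EuclideanSpace ℝ (Fin 3)) × EuclideanSpace ℝ (Fin 3) =>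
            (q.1.1, q.2) := by
        funext q; rfl
      rw [e]
      exact hLO.comp ((contDiff_fst.comp contDiff_fst).prodMk contDiff_snd)
    exact hf.fderiv contDiff_snd (by norm_cast)
  have hGd : Differentiable ℝ fun p : ℝ × EuclideanSpace ℝ (Fin 3) => fderiv ℝ (lerayOrbit V p.1) p.2 :=
    hG.differentiable one_ne_zero
  have h1 : DifferentiableAt ℝ (fun σ : ℝ => fderiv ℝ (lerayOrbit V σ) y) s := by
    have hpair : DifferentiableAt ℝ (fun σ : ℝ => ((σ, y) : ℝ × EuclideanSpace ℝ (Fin 3))) s :=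
      differentiableAt_id.prodMk (differentiableAt_const y)
    exact (hGd (s, y)).comp s hpair
  have e : (fun σ => lerayVorticity V σ y) = fun σ => curlCLM (fderiv ℝ (lerayOrbit V σ) y) := by
    funext σ; rfl
  have hdσ : DifferentiableAt ℝ (fun σ => lerayVorticity V σ y) s := by
    rw [e]; exact curlCLM.differentiableAt.comp s h1
  have hder := hdσ.hasDerivAt
  have key := hV.lerayVorticity_eq s y
  have htd : timeDerivWithin univ (lerayVorticity V) s y = deriv (fun σ => lerayVorticity V σ y) s := by
    rw [timeDerivWithin_apply, derivWithin_univ]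
  rw [htd] at key
  have hval : deriv (fun σ => lerayVorticity V σ y) s =
      (Δ (lerayVorticity V s)) y - lerayVorticity V s y
        - (1 / 2 : ℝ) • fderiv ℝ (lerayVorticity V s) y y
        - fderiv ℝ (lerayVorticity V s) y (lerayOrbit V s y)
        + fderiv ℝ (lerayOrbit V s) y (lerayVorticity V s y) := by
    simp only [convect] at key
    rw [← sub_eq_zero]
    have := sub_eq_zero.mpr key
    rw [← this]
    abel
  rw [hval] at hder
  exact hder

end Summit.NavierStokesRegularity.NavierStokesRegularity.Theorems.SimilarityEnstrophy
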